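import Summits.ValiantsHypothesis.ValiantsHypothesis.Theorems.LacunarySymmetroidMatrixDescartesVLawCoreSigned
import Summits.ValiantsHypothesis.ValiantsHypothesis.Theorems.LacunarySymmetroidMatrixDescartesFanLawThree

/-!
# `MatrixDescartes` (stmt-ValiantsHypothesis-18050), line `Lift` — the SIGNED FAN LAW
# (matrix Descartes rule for the pattern `(+)⋯(+) (?) (−)⋯(−) (?) (+)⋯(+)` on the kernel window)

HONEST FRAMING.  Cell `pub-symmetroid`, seat `val-sym-mdr-p2` (gen 3); helper `--supports` the crux
`Theses.LacunarySymmetroid.MatrixDescartes`, NO closure claim.  Strengthens gen 2's fan laws and this seat's closed-window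
fan law (`…FanLawThree.lean`) in two directions at once; a K-free SECTOR law — nothing here bears on `stub_twoSided`
in general, the crux in its window, `DoorA26`/`DoorA34`, or `VP ≠ VNP`.

**SIGNED FAN LAW** (`fanLawFour_lower`, mirror `fanLawFour_upper`).  `F(X) = X^e J + ∑ k, X^{d k} P k` with `J` real
symmetric (the pivot) and a FACTORING letter `k₀` at gap `a = |d k₀ − e| > 0` which is merely SYMMETRIC (new: no sign
condition on it); every other letter `k` in one of five classes — (Q) opposite side, gap `< a`, `P k ⪰ 0`; (B) opposite
side, gap `= a`, `P k ⪰ 0`; (S) SAME side, gap in `(0, a)` (between the factoring letter and the pivot), `P k ⪯ 0`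
(new: the NEGATIVE window); (R) same side, gap in `(a, 2a)`, `P k ⪰ 0`; (E) same side, gap `= 2a`, `P k ⪰ 0` — and at
least one companion DEFINITE (`≻ 0` in classes Q/B/R/E or `≺ 0` in class S).  Then `det F` has at most `2 · card ι`
distinct positive zeros, for every number of letters and every size.  Read along the exponent axis the sign pattern
is `(+)^* (?) (−)^* (?) (+)^*` with the two free letters at the factoring exponent and at the pivot: at `n = 1` this is
exactly Descartes' `≤ 2` sign changes; for matrices the gap constraints (kernel window) are what the K-free bound needs
(the Cameron–Psarrakos pattern `+ + − + +` with 6 > 4 roots at `n = 2`, tree `cameronPsarrakos_counterexample`, violates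
them).  PROOF.  Chain argument of `…FanLaw.lean` with `VLawCoreSigned.core_pos₅`.  [folklore] given the companion files.
-/

-- layout Summits/ValiantsHypothesis/ValiantsHypothesis forces the duplicated namespace component
set_option linter.dupNamespace false

namespace Summit.ValiantsHypothesis.ValiantsHypothesis.Theorems.LacunarySymmetroidMatrixDescartes

open Polynomial Matrix Finset
open scoped BigOperators

namespace FanLawFour

variable {ι : Type} [Fintype ι] [DecidableEq ι] {κ : Type} [Fintype κ] [DecidableEq κ]

omit [Fintype ι] [DecidableEq ι] in
/-- H-form of a signed lower fan at `t ≠ 0` (five companion classes). [folklore] -/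
theorem pencil_eq_smul_hform₅ (e : ℕ) (d : κ → ℕ) (J : Matrix ι ι ℝ) (P : κ → Matrix ι ι ℝ) (k₀ : κ)
    (hlow : d k₀ ≤ e)
    (hB : ∀ k, k ≠ k₀ → e < d k → ¬ d k - e < e - d k₀ → d k = e + (e - d k₀))
    (hS : ∀ k, k ≠ k₀ → ¬ e < d k → e - d k < e - d k₀ → d k ≤ e)
    (hE : ∀ k, k ≠ k₀ → ¬ e < d k → ¬ e - d k < e - d k₀ → ¬ e - d k < 2 * (e - d k₀) →
      d k + 2 * (e - d k₀) = e)
    {t : ℝ} (ht : t ≠ 0) :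
    t ^ e • J + ∑ k, t ^ d k • P k
      = t ^ e • (J + (t ^ (e - d k₀))⁻¹ • P k₀
          + ∑ l : {k // (k ≠ k₀ ∧ e < d k) ∧ d k - e < e - d k₀}, t ^ (d l.1 - e) • P l.1
          + ∑ m : {k // ((k ≠ k₀ ∧ ¬ e < d k) ∧ ¬ e - d k < e - d k₀) ∧ e - d k < 2 * (e - d k₀)},
              (t ^ (e - d m.1))⁻¹ • P m.1
          + ∑ p : {k // (k ≠ k₀ ∧ e < d k) ∧ ¬ d k - e < e - d k₀}, t ^ (e - d k₀) • P p.1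
          + ∑ r : {k // ((k ≠ k₀ ∧ ¬ e < d k) ∧ ¬ e - d k < e - d k₀) ∧ ¬ e - d k < 2 * (e - d k₀)},
              ((t ^ (e - d k₀)) ^ 2)⁻¹ • P r.1
          + ∑ o : {k // (k ≠ k₀ ∧ ¬ e < d k) ∧ e - d k < e - d k₀}, (t ^ (e - d o.1))⁻¹ • P o.1) := by
  classical
  set A := (Finset.univ.erase k₀).filter (fun k => e < d k) with hA
  set D := (Finset.univ.erase k₀).filter (fun k => ¬ e < d k) with hD
  set D' := D.filter (fun k => ¬ e - d k < e - d k₀) with hD'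
  have hsplit : ∑ k, t ^ d k • P k = t ^ d k₀ • P k₀
      + ((∑ k ∈ A.filter (fun k => d k - e < e - d k₀), t ^ d k • P k
        + ∑ k ∈ A.filter (fun k => ¬ d k - e < e - d k₀), t ^ d k • P k)
      + (∑ k ∈ D.filter (fun k => e - d k < e - d k₀), t ^ d k • P k
        + (∑ k ∈ D'.filter (fun k => e - d k < 2 * (e - d k₀)), t ^ d k • P k
          + ∑ k ∈ D'.filter (fun k => ¬ e - d k < 2 * (e - d k₀)), t ^ d k • P k))) := by
    rw [← Finset.add_sum_erase _ _ (Finset.mem_univ k₀),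
      ← Finset.sum_filter_add_sum_filter_not (Finset.univ.erase k₀) (fun k => e < d k),
      ← Finset.sum_filter_add_sum_filter_not A (fun k => d k - e < e - d k₀),
      ← Finset.sum_filter_add_sum_filter_not D (fun k => e - d k < e - d k₀),
      ← Finset.sum_filter_add_sum_filter_not D' (fun k => e - d k < 2 * (e - d k₀))]
  have memA : ∀ k, k ∈ A ↔ k ≠ k₀ ∧ e < d k := fun k => by simp [hA, Finset.mem_erase, Finset.mem_filter]
  have memD : ∀ k, k ∈ D ↔ k ≠ k₀ ∧ ¬ e < d k := fun k => by simp [hD, Finset.mem_erase, Finset.mem_filter]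
  have memD' : ∀ k, k ∈ D' ↔ (k ≠ k₀ ∧ ¬ e < d k) ∧ ¬ e - d k < e - d k₀ := fun k => by
    rw [hD', Finset.mem_filter, memD]
  have hQ : ∑ k ∈ A.filter (fun k => d k - e < e - d k₀), t ^ d k • P k
      = t ^ e • ∑ l : {k // (k ≠ k₀ ∧ e < d k) ∧ d k - e < e - d k₀}, t ^ (d l.1 - e) • P l.1 := by
    rw [Finset.sum_subtype (A.filter (fun k => d k - e < e - d k₀))
        (p := fun k => (k ≠ k₀ ∧ e < d k) ∧ d k - e < e - d k₀)
        (fun k => by rw [Finset.mem_filter, memA]), Finset.smul_sum]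
    refine Finset.sum_congr rfl fun l _ => ?_
    rw [smul_smul, ← pow_add, show e + (d l.1 - e) = d l.1 by have := l.2.1.2; omega]
  have hBsum : ∑ k ∈ A.filter (fun k => ¬ d k - e < e - d k₀), t ^ d k • P k
      = t ^ e • ∑ p : {k // (k ≠ k₀ ∧ e < d k) ∧ ¬ d k - e < e - d k₀}, t ^ (e - d k₀) • P p.1 := by
    rw [Finset.sum_subtype (A.filter (fun k => ¬ d k - e < e - d k₀))
        (p := fun k => (k ≠ k₀ ∧ e < d k) ∧ ¬ d k - e < e - d k₀)
        (fun k => by rw [Finset.mem_filter, memA]), Finset.smul_sum]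
    refine Finset.sum_congr rfl fun p _ => ?_
    rw [smul_smul, ← pow_add, ← hB p.1 p.2.1.1 p.2.1.2 p.2.2]
  have hSsum : ∑ k ∈ D.filter (fun k => e - d k < e - d k₀), t ^ d k • P k
      = t ^ e • ∑ o : {k // (k ≠ k₀ ∧ ¬ e < d k) ∧ e - d k < e - d k₀}, (t ^ (e - d o.1))⁻¹ • P o.1 := by
    rw [Finset.sum_subtype (D.filter (fun k => e - d k < e - d k₀))
        (p := fun k => (k ≠ k₀ ∧ ¬ e < d k) ∧ e - d k < e - d k₀)
        (fun k => by rw [Finset.mem_filter, memD]), Finset.smul_sum]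
    refine Finset.sum_congr rfl fun o _ => ?_
    rw [smul_smul, ← pow_sub₀ t ht (Nat.sub_le e (d o.1)),
      show e - (e - d o.1) = d o.1 by have := hS o.1 o.2.1.1 o.2.1.2 o.2.2; omega]
  have hR : ∑ k ∈ D'.filter (fun k => e - d k < 2 * (e - d k₀)), t ^ d k • P k
      = t ^ e • ∑ m : {k // ((k ≠ k₀ ∧ ¬ e < d k) ∧ ¬ e - d k < e - d k₀) ∧ e - d k < 2 * (e - d k₀)},
          (t ^ (e - d m.1))⁻¹ • P m.1 := by
    rw [Finset.sum_subtype (D'.filter (fun k => e - d k < 2 * (e - d k₀)))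
        (p := fun k => ((k ≠ k₀ ∧ ¬ e < d k) ∧ ¬ e - d k < e - d k₀) ∧ e - d k < 2 * (e - d k₀))
        (fun k => by rw [Finset.mem_filter, memD']), Finset.smul_sum]
    refine Finset.sum_congr rfl fun m _ => ?_
    rw [smul_smul, ← pow_sub₀ t ht (Nat.sub_le e (d m.1)),
      show e - (e - d m.1) = d m.1 by have := m.2.1.1.2; omega]
  have hEsum : ∑ k ∈ D'.filter (fun k => ¬ e - d k < 2 * (e - d k₀)), t ^ d k • P k
      = t ^ e • ∑ r : {k // ((k ≠ k₀ ∧ ¬ e < d k) ∧ ¬ e - d k < e - d k₀) ∧ ¬ e - d k < 2 * (e - d k₀)},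
          ((t ^ (e - d k₀)) ^ 2)⁻¹ • P r.1 := by
    rw [Finset.sum_subtype (D'.filter (fun k => ¬ e - d k < 2 * (e - d k₀)))
        (p := fun k => ((k ≠ k₀ ∧ ¬ e < d k) ∧ ¬ e - d k < e - d k₀) ∧ ¬ e - d k < 2 * (e - d k₀))
        (fun k => by rw [Finset.mem_filter, memD']), Finset.smul_sum]
    refine Finset.sum_congr rfl fun r _ => ?_
    have hr := hE r.1 r.2.1.1.1 r.2.1.1.2 r.2.1.2 r.2.2
    rw [smul_smul, ← pow_mul, ← pow_sub₀ t ht (show (e - d k₀) * 2 ≤ e by omega),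
      show e - (e - d k₀) * 2 = d r.1 by omega]
  have hP0 : t ^ d k₀ • P k₀ = t ^ e • ((t ^ (e - d k₀))⁻¹ • P k₀) := by
    rw [smul_smul, ← pow_sub₀ t ht (Nat.sub_le e (d k₀)), show e - (e - d k₀) = d k₀ by omega]
  rw [hsplit, hQ, hBsum, hSsum, hR, hEsum, hP0]
  simp only [smul_add]
  abel

/-- **Signed lower fan law.**  Factoring letter `k₀` below the pivot (any real symmetric matrix), gap `a = e − d k₀`;
every other letter: above with gap `< a` and `⪰ 0`, or above with gap `= a` and `⪰ 0`, or below with gap in `(0,a)`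
and `⪯ 0`, or below with gap in `(a, 2a)` and `⪰ 0`, or below with gap `= 2a` and `⪰ 0`; and some companion definite
⇒ `Z₊ ≤ 2 · card ι`. [folklore] -/
theorem fanLawFour_lower (e : ℕ) (d : κ → ℕ) (J : Matrix ι ι ℝ) (P : κ → Matrix ι ι ℝ) (k₀ : κ)
    (hJ : J.IsSymm) (hP₀ : (P k₀).IsSymm) (hlow : d k₀ < e)
    (hfan : ∀ k, k ≠ k₀ → (e < d k ∧ d k - e < e - d k₀ ∧ (P k).PosSemidef)
      ∨ (d k = e + (e - d k₀) ∧ (P k).PosSemidef)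
      ∨ (d k < e ∧ e - d k < e - d k₀ ∧ (-P k).PosSemidef)
      ∨ (d k < e ∧ e - d k₀ < e - d k ∧ e - d k < 2 * (e - d k₀) ∧ (P k).PosSemidef)
      ∨ (d k + 2 * (e - d k₀) = e ∧ (P k).PosSemidef))
    (hdef : ∃ k, k ≠ k₀ ∧ (((P k).PosDef ∧ ¬ (d k < e ∧ e - d k < e - d k₀))
      ∨ ((-P k).PosDef ∧ d k < e ∧ e - d k < e - d k₀))) :
    ((Matrix.det (((Polynomial.X : Polynomial ℝ) ^ e) • J.map Polynomial.C
        + ∑ k, ((Polynomial.X : Polynomial ℝ) ^ d k) • (P k).map Polynomial.C)).roots.toFinset.filter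
          (fun t => 0 < t)).card ≤ 2 * Fintype.card ι := by
  classical
  set p := Matrix.det (((Polynomial.X : Polynomial ℝ) ^ e) • J.map Polynomial.C
        + ∑ k, ((Polynomial.X : Polynomial ℝ) ^ d k) • (P k).map Polynomial.C) with hp
  by_cases hdet : p = 0
  · simp [hdet]
  -- exponent facts for the classes
  have hB : ∀ k, k ≠ k₀ → e < d k → ¬ d k - e < e - d k₀ → d k = e + (e - d k₀) := by
    intro k hk h1 h2
    rcases hfan k hk with h | ⟨h, _⟩ | h | h | ⟨h, _⟩ <;> omega
  have hSle : ∀ k, k ≠ k₀ → ¬ e < d k → e - d k < e - d k₀ → d k ≤ e := fun k _ h _ => Nat.le_of_not_lt h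
  have hE : ∀ k, k ≠ k₀ → ¬ e < d k → ¬ e - d k < e - d k₀ → ¬ e - d k < 2 * (e - d k₀) →
      d k + 2 * (e - d k₀) = e := by
    intro k hk h1 h2 h3
    rcases hfan k hk with h | ⟨h, _⟩ | h | h | ⟨h, _⟩ <;> omega
  -- the H-form data
  set a : ℕ := e - d k₀ with ha_def
  have ha : 0 < a := by omega
  set b : {k // (k ≠ k₀ ∧ e < d k) ∧ d k - e < e - d k₀} → ℕ := fun l => d l.1 - e with hb_def
  set n : {k // (k ≠ k₀ ∧ e < d k) ∧ d k - e < e - d k₀} → ℕ := fun l => a - 1 - b l with hn_def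
  have hb : ∀ l, 0 < b l := fun l => by have := l.2.1.2; simp only [hb_def]; omega
  have hnb : ∀ l, n l + b l + 1 = a := fun l => by
    have := l.2.2; simp only [hn_def, hb_def, ha_def] at this ⊢; omega
  have hRopen : ∀ m : {k // ((k ≠ k₀ ∧ ¬ e < d k) ∧ ¬ e - d k < e - d k₀) ∧ e - d k < 2 * (e - d k₀)},
      e - d k₀ < e - d m.1 ∧ e - d m.1 < 2 * (e - d k₀) ∧ (P m.1).PosSemidef := fun m => by
    rcases hfan m.1 m.2.1.1.1 with h | ⟨h, _⟩ | h | h | ⟨h, _⟩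
    · exact absurd h.1 m.2.1.1.2
    · exfalso; have := m.2.1.1.2; omega
    · exact absurd h.2.1 m.2.1.2
    · exact ⟨h.2.1, h.2.2.1, h.2.2.2⟩
    · exfalso; have := m.2.2; omega
  set c : {k // ((k ≠ k₀ ∧ ¬ e < d k) ∧ ¬ e - d k < e - d k₀) ∧ e - d k < 2 * (e - d k₀)} → ℕ :=
    fun m => e - d m.1 with hc_def
  set b' : {k // ((k ≠ k₀ ∧ ¬ e < d k) ∧ ¬ e - d k < e - d k₀) ∧ e - d k < 2 * (e - d k₀)} → ℕ :=
    fun m => 2 * a - c m with hb'_def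
  set n' : {k // ((k ≠ k₀ ∧ ¬ e < d k) ∧ ¬ e - d k < e - d k₀) ∧ e - d k < 2 * (e - d k₀)} → ℕ :=
    fun m => a - 1 - b' m with hn'_def
  have hb' : ∀ m, 0 < b' m := fun m => by
    have := hRopen m; simp only [hb'_def, hc_def, ha_def] at this ⊢; omega
  have hcb : ∀ m, c m + b' m = 2 * a := fun m => by
    have := hRopen m; simp only [hb'_def, hc_def, ha_def] at this ⊢; omega
  have hnb' : ∀ m, n' m + b' m + 1 = a := fun m => by
    have := hRopen m; simp only [hn'_def, hb'_def, hc_def, ha_def] at this ⊢; omega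
  have hSopen : ∀ o : {k // (k ≠ k₀ ∧ ¬ e < d k) ∧ e - d k < e - d k₀},
      d o.1 < e ∧ (-P o.1).PosSemidef := fun o => by
    rcases hfan o.1 o.2.1.1 with h | ⟨h, _⟩ | h | h | ⟨h, _⟩
    · exact absurd h.1 o.2.1.2
    · exfalso; have := o.2.1.2; omega
    · exact ⟨h.1, h.2.2⟩
    · exfalso; have := o.2.2; omega
    · exfalso; have := o.2.2; omega
  set cn : {k // (k ≠ k₀ ∧ ¬ e < d k) ∧ e - d k < e - d k₀} → ℕ := fun o => e - d o.1 with hcn_def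
  set bn : {k // (k ≠ k₀ ∧ ¬ e < d k) ∧ e - d k < e - d k₀} → ℕ := fun o => a - cn o with hbn_def
  set nn : {k // (k ≠ k₀ ∧ ¬ e < d k) ∧ e - d k < e - d k₀} → ℕ := fun o => a - 1 - bn o with hnn_def
  have hbn : ∀ o, 0 < bn o := fun o => by
    have := o.2.2; simp only [hbn_def, hcn_def, ha_def] at this ⊢; omega
  have hcnb : ∀ o, cn o + bn o = a := fun o => by
    have := o.2.2; simp only [hbn_def, hcn_def, ha_def] at this ⊢; omega
  have hnbn : ∀ o, nn o + bn o + 1 = a := fun o => by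
    have := hSopen o; have h2 := o.2.2; simp only [hnn_def, hbn_def, hcn_def, ha_def] at this h2 ⊢; omega
  set Q : {k // (k ≠ k₀ ∧ e < d k) ∧ d k - e < e - d k₀} → Matrix ι ι ℝ := fun l => P l.1 with hQ_def
  set R : {k // ((k ≠ k₀ ∧ ¬ e < d k) ∧ ¬ e - d k < e - d k₀) ∧ e - d k < 2 * (e - d k₀)} → Matrix ι ι ℝ :=
    fun m => P m.1 with hR_def
  set B : {k // (k ≠ k₀ ∧ e < d k) ∧ ¬ d k - e < e - d k₀} → Matrix ι ι ℝ := fun q => P q.1 with hB_def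
  set E : {k // ((k ≠ k₀ ∧ ¬ e < d k) ∧ ¬ e - d k < e - d k₀) ∧ ¬ e - d k < 2 * (e - d k₀)} → Matrix ι ι ℝ :=
    fun r => P r.1 with hE_def
  set S : {k // (k ≠ k₀ ∧ ¬ e < d k) ∧ e - d k < e - d k₀} → Matrix ι ι ℝ := fun o => P o.1 with hS_def
  have hQ : ∀ l, (Q l).PosSemidef := fun l => by
    rcases hfan l.1 l.2.1.1 with h | ⟨h, _⟩ | h | h | ⟨h, _⟩
    · exact h.2.2
    · exfalso; have := l.2.2; have := l.2.1.2; omega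
    · exact absurd l.2.1.2 (by have := h.1; omega)
    · exact absurd l.2.1.2 (by have := h.1; omega)
    · exfalso; have := l.2.1.2; omega
  have hR : ∀ m, (R m).PosSemidef := fun m => (hRopen m).2.2
  have hBpsd : ∀ q, (B q).PosSemidef := fun q => by
    rcases hfan q.1 q.2.1.1 with h | ⟨_, h⟩ | h | h | ⟨_, h⟩
    · exact h.2.2
    · exact h
    · exact absurd q.2.1.2 (by have := h.1; omega)
    · exact absurd q.2.1.2 (by have := h.1; omega)
    · exact h
  have hEpsd : ∀ r, (E r).PosSemidef := fun r => by
    rcases hfan r.1 r.2.1.1.1 with h | ⟨_, h⟩ | h | h | ⟨_, h⟩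
    · exact h.2.2
    · exact h
    · exact absurd h.2.1 r.2.1.2
    · exact h.2.2.2
    · exact h
  have hSnsd : ∀ o, (-S o).PosSemidef := fun o => (hSopen o).2
  -- the definite companion
  have hPD : (∃ l, (Q l).PosDef) ∨ (∃ m, (R m).PosDef) ∨ (∃ q, (B q).PosDef) ∨ (∃ r, (E r).PosDef)
      ∨ (∃ o, (-S o).PosDef) := by
    obtain ⟨k₁, hk₁, hk⟩ := hdef
    rcases hk with ⟨hpd, hnot⟩ | ⟨hnd, h1, h2⟩
    · by_cases hup : e < d k₁
      · by_cases hq : d k₁ - e < e - d k₀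
        · exact Or.inl ⟨⟨k₁, ⟨hk₁, hup⟩, hq⟩, hpd⟩
        · exact Or.inr (Or.inr (Or.inl ⟨⟨k₁, ⟨hk₁, hup⟩, hq⟩, hpd⟩))
      · have hns : ¬ e - d k₁ < e - d k₀ := fun h => hnot ⟨by
          rcases hfan k₁ hk₁ with h' | ⟨h', _⟩ | h' | h' | ⟨h', _⟩ <;> omega, h⟩
        by_cases hr : e - d k₁ < 2 * (e - d k₀)
        · exact Or.inr (Or.inl ⟨⟨k₁, ⟨⟨hk₁, hup⟩, hns⟩, hr⟩, hpd⟩)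
        · exact Or.inr (Or.inr (Or.inr (Or.inl ⟨⟨k₁, ⟨⟨hk₁, hup⟩, hns⟩, hr⟩, hpd⟩)))
    · exact Or.inr (Or.inr (Or.inr (Or.inr ⟨⟨k₁, ⟨hk₁, by omega⟩, h2⟩, hnd⟩)))
  set G : ℝ → Matrix ι ι ℝ := fun t => t ^ e • J + ∑ k, t ^ d k • P k with hG
  set H : ℝ → Matrix ι ι ℝ := fun t =>
    J + (t ^ a)⁻¹ • P k₀ + ∑ l, t ^ (b l) • Q l + ∑ m, (t ^ (c m))⁻¹ • R m
      + ∑ q, t ^ a • B q + ∑ r, ((t ^ a) ^ 2)⁻¹ • E r + ∑ o, (t ^ (cn o))⁻¹ • S o with hH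
  have hGH : ∀ t : ℝ, t ≠ 0 → G t = t ^ e • H t := fun t ht =>
    pencil_eq_smul_hform₅ e d J P k₀ hlow.le hB hSle hE ht
  set Rt := p.roots.toFinset.filter (fun t => 0 < t) with hRt
  have hroot : ∀ t ∈ Rt, 0 < t ∧ Matrix.det (G t) = 0 := by
    intro t ht
    have h1 := (Finset.mem_filter.1 ht)
    rw [Multiset.mem_toFinset, Polynomial.mem_roots hdet, Polynomial.IsRoot.def, hp,
      StubReverse.eval_det_pencil] at h1
    exact ⟨h1.2, h1.1⟩
  have hkerH : ∀ t : ℝ, 0 < t → ∀ v : ι → ℝ, G t *ᵥ v = 0 → H t *ᵥ v = 0 := by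
    intro t ht v hv
    rw [hGH t ht.ne', smul_mulVec, smul_eq_zero] at hv
    exact hv.resolve_left (pow_ne_zero e ht.ne')
  -- slope of the Rayleigh quotient at a node
  set σ : ℝ → (ι → ℝ) → ℝ := fun t v =>
    -((a : ℝ) * (t ^ a)⁻¹ * (v ⬝ᵥ (P k₀ *ᵥ v))) + ∑ l, (b l : ℝ) * t ^ (b l) * (v ⬝ᵥ (Q l *ᵥ v))
      - ∑ m, (c m : ℝ) * (t ^ (c m))⁻¹ * (v ⬝ᵥ (R m *ᵥ v))
      + ∑ q, (a : ℝ) * t ^ a * (v ⬝ᵥ (B q *ᵥ v))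
      - ∑ r, (2 * a : ℝ) * ((t ^ a) ^ 2)⁻¹ * (v ⬝ᵥ (E r *ᵥ v))
      - ∑ o, (cn o : ℝ) * (t ^ (cn o))⁻¹ * (v ⬝ᵥ (S o *ᵥ v)) with hσ
  set TA : ℝ → Prop := fun t => ∃ v : ι → ℝ, v ≠ 0 ∧ G t *ᵥ v = 0 ∧ 0 ≤ σ t v with hTA
  set TD : ℝ → Prop := fun t => ∃ v : ι → ℝ, v ≠ 0 ∧ G t *ᵥ v = 0 ∧ σ t v ≤ 0 with hTD
  have hcover : Rt ⊆ Rt.filter TA ∪ Rt.filter TD := by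
    intro t ht
    obtain ⟨v, hv, hGv⟩ := Matrix.exists_mulVec_eq_zero_iff.2 (hroot t ht).2
    rcases le_total 0 (σ t v) with h | h
    · exact Finset.mem_union.2 (Or.inl (Finset.mem_filter.2 ⟨ht, v, hv, hGv, h⟩))
    · exact Finset.mem_union.2 (Or.inr (Finset.mem_filter.2 ⟨ht, v, hv, hGv, h⟩))
  -- the signed STAR core lemma, specialised
  have hcore : ∀ (mm : ℕ) (u : Fin mm → ℝ) (w : Fin mm → ι → ℝ), (∀ j, 0 < u j) → Function.Injective u →
      LinearIndependent ℝ w → (∀ j, G (u j) *ᵥ w j = 0) → ∀ s : ℝ, 0 < s → (∀ j, s ≠ u j) →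
      (∀ j, 0 ≤ (s - u j) * σ (u j) (w j)) → ∀ cc : Fin mm → ℝ, cc ≠ 0 →
      0 < (∑ j, cc j • w j) ⬝ᵥ (G s *ᵥ ∑ j, cc j • w j) := by
    intro mm u w hu huinj hwli hker s hs hsu hstar cc hcc
    have h := VLawCoreSigned.core_pos₅ a ha b n hnb hb c n' b' hnb' hb' hcb cn nn bn hnbn hbn hcnb J (P k₀)
      Q R B E S hJ hP₀ hQ hR hBpsd hEpsd hSnsd u hu huinj w hwli (fun j => hkerH _ (hu j) _ (hker j)) s hs hsu
      hstar hPD cc hcc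
    rw [hGH s hs.ne', smul_mulVec, dotProduct_smul, smul_eq_mul]
    exact mul_pos (pow_pos hs e) h
  -- ascending zeros: at most `card ι`
  have hcardA : (Rt.filter TA).card ≤ Fintype.card ι := by
    set RA := Rt.filter TA with hRA
    let τ : Fin RA.card ↪o ℝ := RA.orderEmbOfFin rfl
    have hτmem : ∀ j, τ j ∈ RA := fun j => RA.orderEmbOfFin_mem rfl j
    have hτA : ∀ j, TA (τ j) := fun j => (Finset.mem_filter.1 (hτmem j)).2
    have hτpos : ∀ j, 0 < τ j := fun j => (hroot _ (Finset.mem_filter.1 (hτmem j)).1).1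
    choose v hv0 hker htyp using hτA
    have hli : LinearIndependent ℝ v :=
      VLawChain.linearIndependent_of_chain G τ v hv0 hker fun j hj hpre cc hcc =>
        hcore j (fun i => τ (Fin.castLE hj.le i)) (fun i => v (Fin.castLE hj.le i))
          (fun i => hτpos _)
          (fun i i' h => Fin.castLE_injective hj.le (τ.injective h))
          hpre (fun i => hker _) (τ ⟨j, hj⟩) (hτpos _)
          (fun i => (τ.strictMono (show Fin.castLE hj.le i < ⟨j, hj⟩ from i.2)).ne')
          (fun i => mul_nonneg (sub_nonneg.2
            (τ.strictMono (show Fin.castLE hj.le i < ⟨j, hj⟩ from i.2)).le) (htyp _)) cc hcc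
    have h := hli.fintype_card_le_finrank
    rwa [Fintype.card_fin, Module.finrank_fintype_fun_eq_card] at h
  -- descending zeros: at most `card ι`
  have hcardD : (Rt.filter TD).card ≤ Fintype.card ι := by
    set RD := Rt.filter TD with hRD
    let τ₀ : Fin RD.card ↪o ℝ := RD.orderEmbOfFin rfl
    set τ : Fin RD.card → ℝ := fun j => τ₀ (Fin.rev j) with hτ
    have hτanti : StrictAnti τ := fun i i' h => τ₀.strictMono (Fin.rev_lt_rev.2 h)
    have hτmem : ∀ j, τ j ∈ RD := fun j => RD.orderEmbOfFin_mem rfl (Fin.rev j)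
    have hτD : ∀ j, TD (τ j) := fun j => (Finset.mem_filter.1 (hτmem j)).2
    have hτpos : ∀ j, 0 < τ j := fun j => (hroot _ (Finset.mem_filter.1 (hτmem j)).1).1
    choose v hv0 hker htyp using hτD
    have hli : LinearIndependent ℝ v :=
      VLawChain.linearIndependent_of_chain G τ v hv0 hker fun j hj hpre cc hcc =>
        hcore j (fun i => τ (Fin.castLE hj.le i)) (fun i => v (Fin.castLE hj.le i))
          (fun i => hτpos _)
          (fun i i' h => Fin.castLE_injective hj.le (hτanti.injective h))
          hpre (fun i => hker _) (τ ⟨j, hj⟩) (hτpos _)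
          (fun i => (hτanti (show Fin.castLE hj.le i < ⟨j, hj⟩ from i.2)).ne)
          (fun i => mul_nonneg_of_nonpos_of_nonpos (sub_nonpos.2
            (hτanti (show Fin.castLE hj.le i < ⟨j, hj⟩ from i.2)).le) (htyp _)) cc hcc
    have h := hli.fintype_card_le_finrank
    rwa [Fintype.card_fin, Module.finrank_fintype_fun_eq_card] at h
  calc Rt.card ≤ (Rt.filter TA ∪ Rt.filter TD).card := Finset.card_le_card hcover
    _ ≤ (Rt.filter TA).card + (Rt.filter TD).card := Finset.card_union_le _ _
    _ ≤ Fintype.card ι + Fintype.card ι := Nat.add_le_add hcardA hcardD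
    _ = 2 * Fintype.card ι := by ring

/-- **Signed upper fan law** (mirror, via `stub_reverse`): factoring letter `k₀` above the pivot, gap `a = d k₀ − e`;
every other letter: below with gap `< a` (`⪰ 0`), below with gap `= a` (`⪰ 0`), above with gap in `(0, a)` (`⪯ 0`),
above with gap in `(a, 2a)` (`⪰ 0`), above with gap `= 2a` (`⪰ 0`); some companion definite. [folklore] -/
theorem fanLawFour_upper (e : ℕ) (d : κ → ℕ) (J : Matrix ι ι ℝ) (P : κ → Matrix ι ι ℝ) (k₀ : κ)
    (hJ : J.IsSymm) (hP₀ : (P k₀).IsSymm) (hup : e < d k₀)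
    (hfan : ∀ k, k ≠ k₀ → (d k < e ∧ e - d k < d k₀ - e ∧ (P k).PosSemidef)
      ∨ (d k + (d k₀ - e) = e ∧ (P k).PosSemidef)
      ∨ (e < d k ∧ d k - e < d k₀ - e ∧ (-P k).PosSemidef)
      ∨ (e < d k ∧ d k₀ - e < d k - e ∧ d k - e < 2 * (d k₀ - e) ∧ (P k).PosSemidef)
      ∨ (d k = e + 2 * (d k₀ - e) ∧ (P k).PosSemidef))
    (hdef : ∃ k, k ≠ k₀ ∧ (((P k).PosDef ∧ ¬ (e < d k ∧ d k - e < d k₀ - e))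
      ∨ ((-P k).PosDef ∧ e < d k ∧ d k - e < d k₀ - e))) :
    ((Matrix.det (((Polynomial.X : Polynomial ℝ) ^ e) • J.map Polynomial.C
        + ∑ k, ((Polynomial.X : Polynomial ℝ) ^ d k) • (P k).map Polynomial.C)).roots.toFinset.filter
          (fun t => 0 < t)).card ≤ 2 * Fintype.card ι := by
  have hd : ∀ k, d k ≤ 2 * d k₀ := by
    intro k
    by_cases hk : k = k₀
    · rw [hk]; omega
    · rcases hfan k hk with h | ⟨h, _⟩ | h | h | ⟨h, _⟩ <;> omega
  rw [stub_reverse ι κ e (2 * d k₀) d J P (by omega) hd]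
  refine fanLawFour_lower (2 * d k₀ - e) (fun k => 2 * d k₀ - d k) J P k₀ hJ hP₀
    (show 2 * d k₀ - d k₀ < 2 * d k₀ - e by omega) (fun k hk => ?_) ?_
  · rcases hfan k hk with ⟨h1, h2, h3⟩ | ⟨h, h3⟩ | ⟨h1, h2, h3⟩ | ⟨h1, h2, h4, h3⟩ | ⟨h, h3⟩
    · exact Or.inl ⟨by omega, by omega, h3⟩
    · exact Or.inr (Or.inl ⟨by omega, h3⟩)
    · exact Or.inr (Or.inr (Or.inl ⟨by omega, by omega, h3⟩))
    · exact Or.inr (Or.inr (Or.inr (Or.inl ⟨by omega, by omega, by omega, h3⟩)))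
    · have := hd k
      exact Or.inr (Or.inr (Or.inr (Or.inr ⟨by omega, h3⟩)))
  · obtain ⟨k₁, hk₁, hk⟩ := hdef
    have hk₁' := hd k₁
    refine ⟨k₁, hk₁, ?_⟩
    rcases hk with ⟨hpd, hnot⟩ | ⟨hnd, h1, h2⟩
    · refine Or.inl ⟨hpd, fun h => hnot ⟨by omega, by omega⟩⟩
    · exact Or.inr ⟨hnd, by omega, by omega⟩

end FanLawFour

end Summit.ValiantsHypothesis.ValiantsHypothesis.Theorems.LacunarySymmetroidMatrixDescartes
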